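import Mathlib
import Summits.Ventures.PercRepro2.Defs
import Summits.Ventures.PercRepro2.Harris
import Summits.Ventures.PercRepro2.Graph
import Summits.Ventures.PercRepro2.Events
import Summits.Ventures.PercRepro2.TReduction
import Summits.Ventures.PercRepro2.TReductionBase
import Summits.Ventures.PercRepro2.AntipodalHarris

/-!
# (T_h) from the deletion-monotonicity of the antipodal sums at `h` (blind cell PercRepro2, mine-a g42)

`TReduction` / `TReductionBase` reduce the cell's three-event inequality (T_h) for every admissible
weight vector to the *antipodal base cases*: for every `D` and every `a` that is `0/1`-valued off
`D`, `K_D(a) = Σ_{σ supported on D} 1_Q(c_σ)(1_U(c_σ) − 1_U(c_σ̄))(1_e(c_σ) − 1_e(c_σ̄)) ≥ 0`, the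
uniform 2-colouring inequality on the minor `G_a` with edge set `D`.  This file reduces the base
cases further, to a *monotonicity* statement: **deleting an antipodal edge at `h` does not increase
the antipodal sum**,

  `(MONO_h)   K_{D ∖ {g}}(a[g ↦ 0]) ≤ K_D(a)`   for every `g ∈ D` touching the class of `h`

(the class of `h` = the vertices joined to `h` by the edges pinned open by `a`; `g` is "at `h`" in
the minor).  Given (MONO_h) on every minor, `kform_nonneg_of_deletionMono` proves every base case by
induction on `D`: while some edge of `D` touches the class of `h`, delete it; when none does, the
class of `h` is a union of clusters in every 2-colouring, so `1_Q(c_σ)` is the constant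
`1[s ∈ class of h]` and the antipodal sum is the Harris form
`Σ_σ (1_U(c_σ) − 1_U(c_σ̄))(1_e(c_σ) − 1_e(c_σ̄)) ≥ 0` of `AntipodalHarris.lean`.
`t_cluster_of_deletionMono` states the consequence: (T_h) for every admissible weight vector from
(MONO_h) on the minors.  Exact census of (MONO_h) (principal events, all triples `(h, a, b)`, all
edges incident to `h`): all connected multigraphs with `n ≤ 5` vertices and `m ≤ 8` edges, `n = 6`
and `m ≤ 8`, 0 violations (MINE-A.md §97; the plain monotonicity for edges not at `h` fails).
No instance, no notation.
-/

namespace Summit.Ventures.PercRepro2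

namespace TReduction

open Finset

/-! ## The class of `h` in a minor, and the induction -/

section Minor

variable {E : Type*} [Fintype E] [DecidableEq E] {R : Type*} [Field R] [LinearOrder R]
  [IsStrictOrderedRing R] {V : Type*}

/-- The configuration of the edges pinned open by `a` off `D`. -/
def pinnedOpenConfig (a : E → R) (D : Finset E) : Config E := fun x => decide (x ∉ D ∧ a x = 1)

omit [Fintype E] [IsStrictOrderedRing R] in
/-- The pinned-open edges are open in every base configuration. -/
lemma pinnedOpenConfig_le_baseConfig (a : E → R) (D : Finset E) (σ : Config E) :
    pinnedOpenConfig a D ≤ baseConfig a D σ := by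
  intro x
  by_cases hx : x ∈ D
  · simp [pinnedOpenConfig, hx]
  · simp [pinnedOpenConfig, baseConfig, hx]

omit [Fintype E] [IsStrictOrderedRing R] in
/-- **The class of `h` is its cluster in every 2-colouring** when no edge of `D` touches it. -/
lemma cluster_baseConfig_eq_of_not_touches (ends : E → Sym2 V) (a : E → R) (D : Finset E) (h : V)
    (hD : ∀ g ∈ D, g ∉ touches ends (cluster ends (pinnedOpenConfig a D) h)) (σ : Config E) :
    cluster ends (baseConfig a D σ) h = cluster ends (pinnedOpenConfig a D) h := by
  apply Set.Subset.antisymm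
  · intro v hv
    refine mem_of_conn_of_closed (ends := ends) (ω := baseConfig a D σ)
      (S := cluster ends (pinnedOpenConfig a D) h) ?_ (mem_cluster_self ends _ h) hv
    intro x hx y hxy
    rw [openGraph_adj] at hxy
    obtain ⟨hne, g, hg, hends⟩ := hxy
    by_cases hgD : g ∈ D
    · exact absurd (mem_touches_of_ends hends (Or.inl hx)) (hD g hgD)
    · have hg1 : a g = 1 := by
        simp only [baseConfig, hgD, if_false, decide_eq_true_eq] at hg
        exact hg
      have hadj : (openGraph ends (pinnedOpenConfig a D)).Adj x y := by
        rw [openGraph_adj]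
        exact ⟨hne, g, by simp [pinnedOpenConfig, hgD, hg1], hends⟩
      exact mem_cluster_of_adj hx hadj
  · exact cluster_mono (pinnedOpenConfig_le_baseConfig a D σ) h

omit [Fintype E] [IsStrictOrderedRing R] in
/-- The indicator of `{h ∈ C(s)}` at a base configuration is the constant `1[s ∈ class of h]`
when no edge of `D` touches the class of `h`. -/
lemma indicator_hit_baseConfig_eq (ends : E → Sym2 V) (a : E → R) (D : Finset E) (s h : V)
    (hD : ∀ g ∈ D, g ∉ touches ends (cluster ends (pinnedOpenConfig a D) h)) (σ : Config E) :
    (clusterInEvent ends s {T : Set V | h ∈ T}).indicator (fun _ => (1 : R)) (baseConfig a D σ) =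
      (cluster ends (pinnedOpenConfig a D) h).indicator (fun _ => (1 : R)) s := by
  have hmem : baseConfig a D σ ∈ clusterInEvent ends s {T : Set V | h ∈ T} ↔
      s ∈ cluster ends (pinnedOpenConfig a D) h := by
    rw [← cluster_baseConfig_eq_of_not_touches ends a D h hD σ]
    simp only [mem_clusterInEvent, Set.mem_setOf_eq, mem_cluster]
    exact ⟨conn_symm, conn_symm⟩
  by_cases hs : s ∈ cluster ends (pinnedOpenConfig a D) h
  · rw [Set.indicator_of_mem hs, Set.indicator_of_mem (hmem.2 hs)]
  · rw [Set.indicator_of_notMem hs, Set.indicator_of_notMem (fun hm => hs (hmem.1 hm))]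

/-- **Every base case from deletion-monotonicity at `h`**: for the cluster events
`Q = {h ∈ C_s}`, `U = {C_s ∈ 𝓤}`, `e = {C_s ∈ 𝓥}` (`𝓤 𝓥` up-sets), if deleting an antipodal edge
touching the class of `h` never increases the antipodal sum, then every antipodal base case is
nonnegative. -/
theorem kform_nonneg_of_deletionMono (ends : E → Sym2 V) (s h : V) {𝓤 𝓥 : Set (Set V)}
    (h𝓤 : IsUpperSet 𝓤) (h𝓥 : IsUpperSet 𝓥)
    (hmono : ∀ (D : Finset E) (a : E → R), IsProbVec a → (∀ x, x ∉ D → a x = 0 ∨ a x = 1) →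
      ∀ g ∈ D, g ∈ touches ends (cluster ends (pinnedOpenConfig a D) h) →
        kform (clusterInEvent ends s {T : Set V | h ∈ T}) (clusterInEvent ends s 𝓤)
            (clusterInEvent ends s 𝓥) (D.erase g) (Function.update a g 0) ≤
          kform (clusterInEvent ends s {T : Set V | h ∈ T}) (clusterInEvent ends s 𝓤)
            (clusterInEvent ends s 𝓥) D a) :
    ∀ (D : Finset E) (a : E → R), IsProbVec a → (∀ x, x ∉ D → a x = 0 ∨ a x = 1) →
      0 ≤ kform (clusterInEvent ends s {T : Set V | h ∈ T}) (clusterInEvent ends s 𝓤)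
        (clusterInEvent ends s 𝓥) D a := by
  -- the terminal case: no edge of `D` touches the class of `h`
  have hterm : ∀ (D : Finset E) (a : E → R), IsProbVec a → (∀ x, x ∉ D → a x = 0 ∨ a x = 1) →
      (∀ g ∈ D, g ∉ touches ends (cluster ends (pinnedOpenConfig a D) h)) →
      0 ≤ kform (clusterInEvent ends s {T : Set V | h ∈ T}) (clusterInEvent ends s 𝓤)
        (clusterInEvent ends s 𝓥) D a := by
    intro D a ha0 ha hD
    rw [kform_eq_antipodal_sum _ _ _ ha]
    have hconst : ∀ σ ∈ suppOn D,
        (clusterInEvent ends s {T : Set V | h ∈ T}).indicator (fun _ => (1 : R)) (baseConfig a D σ)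
          * ((clusterInEvent ends s 𝓤).indicator (fun _ => (1 : R)) (baseConfig a D σ)
              - (clusterInEvent ends s 𝓤).indicator (fun _ => (1 : R))
                  (baseConfig a D fun x => !σ x))
          * ((clusterInEvent ends s 𝓥).indicator (fun _ => (1 : R)) (baseConfig a D σ)
              - (clusterInEvent ends s 𝓥).indicator (fun _ => (1 : R))
                  (baseConfig a D fun x => !σ x)) =
        (cluster ends (pinnedOpenConfig a D) h).indicator (fun _ => (1 : R)) s
          * (((clusterInEvent ends s 𝓤).indicator (fun _ => (1 : R)) (baseConfig a D σ)
              - (clusterInEvent ends s 𝓤).indicator (fun _ => (1 : R))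
                  (baseConfig a D fun x => !σ x))
          * ((clusterInEvent ends s 𝓥).indicator (fun _ => (1 : R)) (baseConfig a D σ)
              - (clusterInEvent ends s 𝓥).indicator (fun _ => (1 : R))
                  (baseConfig a D fun x => !σ x))) := by
      intro σ _
      rw [indicator_hit_baseConfig_eq ends a D s h hD σ, mul_assoc]
    rw [sum_congr rfl hconst, ← mul_sum]
    refine mul_nonneg (Set.indicator_apply_nonneg fun _ => zero_le_one) ?_
    exact antipodal_sum_nonneg_of_isUpperSet (isUpperSet_clusterInEvent ends s h𝓤)
      (isUpperSet_clusterInEvent ends s h𝓥) ha0 ha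
  -- induction on the number of antipodal edges
  suffices hn : ∀ n : ℕ, ∀ (D : Finset E) (a : E → R), IsProbVec a →
      (∀ x, x ∉ D → a x = 0 ∨ a x = 1) → D.card = n →
      0 ≤ kform (clusterInEvent ends s {T : Set V | h ∈ T}) (clusterInEvent ends s 𝓤)
        (clusterInEvent ends s 𝓥) D a from fun D a ha0 ha => hn _ D a ha0 ha rfl
  intro n
  induction n with
  | zero =>
    intro D a ha0 ha hn
    rw [card_eq_zero] at hn
    subst hn
    exact hterm ∅ a ha0 ha fun g hg => absurd hg (notMem_empty g)
  | succ n ih =>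
    intro D a ha0 ha hn
    by_cases hex : ∃ g ∈ D, g ∈ touches ends (cluster ends (pinnedOpenConfig a D) h)
    · obtain ⟨g, hgD, hgt⟩ := hex
      have ha' : ∀ x, x ∉ D.erase g → Function.update a g 0 x = 0 ∨ Function.update a g 0 x = 1 := by
        intro x hx
        by_cases hxg : x = g
        · subst hxg; simp
        · rw [Function.update_of_ne hxg]
          exact ha x fun hxD => hx (mem_erase.2 ⟨hxg, hxD⟩)
      have hcard : (D.erase g).card = n := by
        rw [card_erase_of_mem hgD, hn]; rfl
      exact le_trans (ih (D.erase g) _ (ha0.update g le_rfl zero_le_one) ha' hcard)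
        (hmono D a ha0 ha g hgD hgt)
    · simp only [not_exists, not_and] at hex
      exact hterm D a ha0 ha hex

/-- **(T_h) from deletion-monotonicity at `h`**: for admissible weights, a root `s`, a vertex `h`
and up-sets `𝓤 𝓥` of vertex sets, if on every minor the deletion of an antipodal edge touching the
class of `h` does not increase the antipodal sum, then (T_h) holds in the form of
`TFKG.t_of_isForest`. -/
theorem t_cluster_of_deletionMono (p : E → R) (hp : IsProbVec p) (ends : E → Sym2 V) (s h : V)
    {𝓤 𝓥 : Set (Set V)} (h𝓤 : IsUpperSet 𝓤) (h𝓥 : IsUpperSet 𝓥)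
    (hmono : ∀ (D : Finset E) (a : E → R), IsProbVec a → (∀ x, x ∉ D → a x = 0 ∨ a x = 1) →
      ∀ g ∈ D, g ∈ touches ends (cluster ends (pinnedOpenConfig a D) h) →
        kform (clusterInEvent ends s {T : Set V | h ∈ T}) (clusterInEvent ends s 𝓤)
            (clusterInEvent ends s 𝓥) (D.erase g) (Function.update a g 0) ≤
          kform (clusterInEvent ends s {T : Set V | h ∈ T}) (clusterInEvent ends s 𝓤)
            (clusterInEvent ends s 𝓥) D a) :
    let Q := clusterInEvent ends s {T : Set V | h ∈ T}
    let U := clusterInEvent ends s 𝓤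
    let e := clusterInEvent ends s 𝓥
    prob p (Q ∩ U) * prob p e + prob p U * prob p (Q ∩ e) ≤
      prob p (Q ∩ U ∩ e) + prob p Q * prob p (U ∩ e) := by
  intro Q U e
  have h := tform_nonneg_of_base Q U e (kform_nonneg_of_deletionMono ends s h h𝓤 h𝓥 hmono) p hp
  linarith [mul_comm (prob p U) (prob p (Q ∩ e))]

end Minor

end TReduction

end Summit.Ventures.PercRepro2
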